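import Literature.NumberTheory.EllipticCurves.ArtinFormalismAbelianGaloisLocalProofs
import Literature.NumberTheory.EllipticCurves.TateModuleTwistNewformEulerFactorsProofs
import Literature.NumberTheory.EllipticCurves.AnalyticRankOverNumberField
import Literature.NumberTheory.EllipticCurves.HasseWeilAbelianLSeriesProofs
import Literature.NumberTheory.EllipticCurves.Gamma1NewformLSeriesProofs
import Literature.NumberTheory.EllipticCurves.CuspFormLFunctionProofs
import Literature.NumberTheory.EllipticCurves.CuspFormTwistGamma1
import Literature.NumberTheory.EllipticCurves.NewformsLiftProofs
import Literature.NumberTheory.EllipticCurves.NewformsProofs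
import Literature.NumberTheory.EllipticCurves.EisensteinNewformLevelRaising
import Literature.NumberTheory.GaloisRepresentations.ArtinLFunctionDirichletProofs
import Literature.NumberTheory.GaloisRepresentations.InducedGaloisRep
import Literature.NumberTheory.GaloisRepresentations.FrobeniusPlaces
import Literature.NumberTheory.GaloisRepresentations.FramedRepTwistEulerFactorProofs
import Literature.NumberTheory.GaloisRepresentations.IntegralGaloisActionProofs
import Literature.NumberTheory.LFunctions.AbelianFieldDedekindZeta
import Literature.FieldTheory.AlgClosed.PadicAlgClEquivComplex
import HarnessLib

/-!
# `L(E/F, s)` is entire for abelian `F` — reduction to modularity, Deligne's representations and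
# Carayol's theorem (proofs only)

A theorems-only companion (no definition, no named fact; D-0026) of the named fact
`Literature.NumberTheory.EllipticCurves.hasEntireLFunction_baseChange_fixedField`
(`AnalyticRankOverNumberField`: for an elliptic curve `E/ℚ`, `m ≥ 1` and a subgroup `H` of
`Gal(ℚ(ζ_m)/ℚ)`, the Hasse–Weil `L`-function of `E` over `F = ℚ(ζ_m)^H` has an entire continuation;
BCDT 2001 Thm. A with Artin formalism, Rohrlich 1997 §3.8–3.9).  The main theorem
`hasEntireLFunction_baseChange_fixedField_of_modularity_of_carayol` proves the fact, with all glue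
proved in the tree, from three inputs:

* `hX : exists_isNewformOf` — the modularity theorem (named fact, `ModularForms`; BCDT Thm. A,
  Diamond–Shurman Thm. 8.8.3);
* `hD : Hida2000_thm326_exists_galoisRep` — Deligne's `ℓ`-adic representations of `Γ₁`-newforms
  over `ℚ̄_ℓ` (named fact, `EisensteinNewformLevelRaising`; reduced in the tree to Deligne–Serre
  Thm. 6.1, `Hida2000_thm326_exists_galoisRep_of_thm61`);
* `hC` — Carayol's theorem (A) in Euler-factor form: for a newform `g` of weight `k ≥ 2`, an
  irreducible `ℓ`-adic representation `ρ` attached to `g` and a prime `p ≠ ℓ`,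
  `det(1 - Frob T | ρ_{I_𝔓}) = ι⁻¹(1 - a_p(g) T + ε_g(p) p^{k-1} T²)` (Carayol, ASENS 1986, Thm. (A)
  with (0.5), (0.8); Rohrlich 1997 §3.1, §3.8 Thm. 5).  No named fact of the tree carries this
  statement yet (the tree's `Carayol1986_finrank_inertiaInvariants` is its dimension count only),
  and a fact-proving unit may not mint one (D-0026), so it is an explicit hypothesis, stated
  verbatim as it would be vendored.

## The argument (Rohrlich 1997, §3.9, "`L(E/F, s) = ∏_χ L(E ⊗ χ, s)`")

1. *Dictionary.* `F = ℚ(ζ_m)^H` is abelian over `ℚ`; with `B ≤ (ℤ/m)ˣ` the image of `H`,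
   `[(ℤ/m)ˣ : B] = [F : ℚ]` and `σ ∈ Γ_ℚ` restricts to `Γ_F` iff `χ_m(σ) ∈ B`
   (`exists_subgroup_index_eq_and_mem_range_absGaloisRestrict_iff`); the characters of
   `Gal(F/ℚ)` are the Dirichlet characters `ε` mod `m` trivial on `B`, with the orthogonality
   relation off `B` (`sum_filter_forall_apply_eq_one_apply_eq_zero`), and each gives a continuous
   character `ψ_ε : Γ_ℚ → ℚ̄_ℓˣ` (`exists_continuousMonoidHom_apply_eq_dirichlet`).
2. *Twisted newforms.* By modularity and Atkin–Li/Shimura there are newforms `g_ε ∈ S₂(Γ₁(N_ε))`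
   with `a_p(g_ε) = ε(p) a_p(E)`, `ε_{g_ε}(p) = ε(p)²` off `N_E m`
   (`exists_isNewform1_cuspCoeff_eq_dirichlet_mul`).
3. *Local identity at every prime* (`map_prod_expand_localPolynomialAt_baseChange_eq_prod_heckeFactor`):
   `∏_{w ∣ p} L_w(E_F, T^{f(w|p)}) = ∏_ε (1 - a_p(g_ε) T + ε_{g_ε}(p) p T²)` — for an auxiliary prime
   `ℓ ≠ p`, the abelian local Artin formalism for `V_ℓ(E)` (`ArtinFormalismAbelianGaloisLocalProofs`,
   Deligne 1973 Prop. 3.8 (ii), Prop. 8.11) writes the left side as `∏_ε det(1 - Frob T | (V_ℓ(E) ⊗ ψ_ε)_{I})`;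
   `V_ℓ(E) ⊗ ψ_ε ≅ ρ_{g_ε,ℓ}` (`TateModuleTwistNewformEulerFactorsProofs`, Chebotarev + Brauer–Nesbitt
   with one irreducible side) and Carayol (`hC`) give the right side.  This covers the primes of
   additive reduction and the primes ramified in `F` uniformly.
4. *Euler products* (`LSeries_eq_prod_cuspFormLSeries_of_forall_map_prod_expand_eq`): for
   `Re s > 2`, `L(E_F, s) = ∏_w L_w(N w^{-s})⁻¹` (Silverman C.16, proved in the tree) regrouped over
   the rational primes equals `∏_ε ∏_p E_p(g_ε, p^{-s})⁻¹ = ∏_ε L(g_ε, s)` (Deligne–Serre (1.7.2),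
   proved in the tree).
5. *Continuation.* Each `L(g_ε, s)` is entire (Hecke; `exists_differentiable_eq_cuspFormLSeries_of_lt_re`),
   and the identity extends from `Re s > 2` to `Re s > 3/2` by analytic continuation
   (`LSeriesSummable_of_lt_re_holds`).

## References

* C. Breuil, B. Conrad, F. Diamond, R. Taylor, *On the modularity of elliptic curves over ℚ: wild
  3-adic exercises*, JAMS 14 (2001), Thm. A. [BCDTJAMS2001]
* D. E. Rohrlich, *Modular curves, Hecke correspondences, and L-functions*, in Cornell–Silverman–
  Stevens (1997), §3.8 Thm. 5, §3.9 (PDF pp. 152–156). [Rohrlich1997]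
* H. Carayol, *Sur les représentations ℓ-adiques associées aux formes modulaires de Hilbert*,
  ASENS 19 (1986), Thm. (A), (0.5), (0.8), pp. 410–411. [CarayolASENS1986]
* P. Deligne, *Les constantes des équations fonctionnelles des fonctions L*, Antwerp II, LNM 349
  (1973), Prop. 3.8 (ii), Prop. 8.11. [DeligneAntwerpII1973]
* P. Deligne, J.-P. Serre, *Formes modulaires de poids 1*, ASENS 7 (1974), (1.7.2), §4.4.
  [DeligneSerreASENS1974]
* G. Shimura, *Introduction to the Arithmetic Theory of Automorphic Functions* (1971), Prop. 3.64.
  [Shimura1971]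
* L. C. Washington, *Introduction to Cyclotomic Fields*, 2nd ed. (1997), Ch. 3. [Washington1997]

## Mathlib / tree search

`hasEntireLFunction_baseChange_fixedField_of_exists_isNewformOf_of_forall` (semistable level,
`AnalyticRankOverNumberFieldAbelianProofs`) and `…QuadraticRescueProofs` cover special cases only;
`lean search 'fixedField.*Carayol|of_modularity_of_carayol|prod_heckeFactor'`: no prior hits.
-/

noncomputable section

open scoped NumberField Polynomial MatrixGroups Pointwise
open NumberField IsDedekindDomain IsDedekindDomain.HeightOneSpectrum Field Polynomial
  Rat.HeightOneSpectrum CongruenceSubgroup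
  Literature.NumberTheory.GaloisRepresentations Literature.NumberTheory.EllipticCurves
  Literature.NumberTheory.EllipticCurves.ModularForms

namespace Literature.NumberTheory.EllipticCurves

universe u

/-! ### The Galois dictionary for `F = ℚ(ζ_m)^H` -/

section Dictionary

variable (m : ℕ) [NeZero m]

omit [NeZero m] in
/-- An extension of the chosen embedding `e : F → ℚ̄` (`absEmbedding ℚ F`) of the abelian field
`F = ℚ(ζ_m)^H` to a `ℚ`-embedding of `ℚ(ζ_m)` (`ℚ̄` is algebraically closed). [folklore] -/
theorem exists_algHom_cyclotomicField_extends_absEmbedding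
    (H : Subgroup (CyclotomicField m ℚ ≃ₐ[ℚ] CyclotomicField m ℚ)) :
    ∃ eL : CyclotomicField m ℚ →ₐ[ℚ] AlgebraicClosure ℚ,
      ∀ x : IntermediateField.fixedField H,
        eL (x : CyclotomicField m ℚ) = absEmbedding ℚ (IntermediateField.fixedField H) x := by
  set F := IntermediateField.fixedField H with hF
  letI alg : Algebra F (AlgebraicClosure ℚ) := (absEmbedding ℚ F).toRingHom.toAlgebra
  haveI : IsScalarTower ℚ F (AlgebraicClosure ℚ) :=
    IsScalarTower.of_algebraMap_eq fun q => ((absEmbedding ℚ F).commutes q).symm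
  haveI : Algebra.IsAlgebraic F (CyclotomicField m ℚ) := Algebra.IsAlgebraic.of_finite F _
  let eL : CyclotomicField m ℚ →ₐ[F] AlgebraicClosure ℚ := IsAlgClosed.lift
  refine ⟨eL.restrictScalars ℚ, fun x => ?_⟩
  rw [AlgHom.restrictScalars_apply]
  exact eL.commutes x

/-- **The Galois dictionary for an abelian field.**  Let `F = ℚ(ζ_m)^H` for a subgroup `H` of
`Gal(ℚ(ζ_m)/ℚ) ≅ (ℤ/m)ˣ` and let `B ≤ (ℤ/m)ˣ` be the image of `H`.  Then `[(ℤ/m)ˣ : B] = [F : ℚ]`,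
and an element `σ` of the absolute Galois group `Γ_ℚ` lies in (the image of) `Γ_F` iff its mod-`m`
cyclotomic character `χ_m(σ)` lies in `B`: `σ` fixes the copy of `F` inside `ℚ̄` iff its
restriction to `ℚ(ζ_m)` lies in `Gal(ℚ(ζ_m)/F) = H`, and that restriction is read off from
`χ_m(σ)` (`galEquivZMod_restrictNormalHom_eq_modNCyclotomicCharacter`).
[cite: Washington1997, Ch. 3, Thm. 3.7 and p. 19] -/
theorem exists_subgroup_index_eq_and_mem_range_absGaloisRestrict_iff
    (H : Subgroup (CyclotomicField m ℚ ≃ₐ[ℚ] CyclotomicField m ℚ)) :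
    ∃ B : Subgroup (ZMod m)ˣ,
      B.index = Module.finrank ℚ (IntermediateField.fixedField H) ∧
      ∀ σ : absoluteGaloisGroup ℚ,
        σ ∈ (absGaloisRestrict ℚ (IntermediateField.fixedField H)).range ↔
          modNCyclotomicCharacter ℚ m σ ∈ B := by
  classical
  haveI : NeZero ((m : ℕ) : ℚ) := NeZero.charZero
  haveI hcyc : IsCyclotomicExtension {m} ℚ (CyclotomicField m ℚ) :=
    CyclotomicField.isCyclotomicExtension m ℚ
  set F := IntermediateField.fixedField H with hF
  haveI hG : IsGalois ℚ (CyclotomicField m ℚ) :=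
    IsCyclotomicExtension.isGalois {m} ℚ (CyclotomicField m ℚ)
  obtain ⟨eL, heL⟩ := exists_algHom_cyclotomicField_extends_absEmbedding m H
  letI algL : Algebra (CyclotomicField m ℚ) (AlgebraicClosure ℚ) := eL.toRingHom.toAlgebra
  haveI : IsScalarTower ℚ (CyclotomicField m ℚ) (AlgebraicClosure ℚ) :=
    IsScalarTower.of_algebraMap_eq fun q => (eL.commutes q).symm
  set gal : (CyclotomicField m ℚ ≃ₐ[ℚ] CyclotomicField m ℚ) ≃* (ZMod m)ˣ :=
    IsCyclotomicExtension.Rat.galEquivZMod m (CyclotomicField m ℚ) with hgal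
  refine ⟨H.map gal.toMonoidHom, ?_, fun σ => ?_⟩
  · -- `[(ℤ/m)ˣ : B] = [G : H] = [F : ℚ]`
    rw [Subgroup.index_map_of_bijective (f := gal.toMonoidHom) gal.bijective]
    have h1 : Module.finrank F (CyclotomicField m ℚ) = Nat.card H :=
      IntermediateField.finrank_fixedField_eq_card H
    have h2 : Nat.card (CyclotomicField m ℚ ≃ₐ[ℚ] CyclotomicField m ℚ) =
        Module.finrank ℚ (CyclotomicField m ℚ) :=
      IsGalois.card_aut_eq_finrank ℚ (CyclotomicField m ℚ)
    have h3 : Module.finrank ℚ F * Module.finrank F (CyclotomicField m ℚ) =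
        Module.finrank ℚ (CyclotomicField m ℚ) :=
      Module.finrank_mul_finrank ℚ F (CyclotomicField m ℚ)
    have h4 : Nat.card H * H.index = Nat.card (CyclotomicField m ℚ ≃ₐ[ℚ] CyclotomicField m ℚ) :=
      H.card_mul_index
    have hpos : 0 < Nat.card H := Nat.card_pos
    rw [h1, ← h2, ← h4, mul_comm] at h3
    exact (Nat.eq_of_mul_eq_mul_left hpos h3).symm
  · -- `σ ∈ res(Γ_F) ↔ σ|_L ∈ H ↔ χ_m(σ) ∈ B`
    set τ : CyclotomicField m ℚ ≃ₐ[ℚ] CyclotomicField m ℚ :=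
      AlgEquiv.restrictNormalHom (CyclotomicField m ℚ) (absoluteGaloisGroup.toAlgEquiv ℚ σ) with hτ
    have hdict : gal τ = modNCyclotomicCharacter ℚ m σ :=
      galEquivZMod_restrictNormalHom_eq_modNCyclotomicCharacter (m := m) (CyclotomicField m ℚ) σ
    have hmemB : modNCyclotomicCharacter ℚ m σ ∈ H.map gal.toMonoidHom ↔ τ ∈ H := by
      rw [← hdict]
      constructor
      · rintro ⟨τ', hτ', h⟩
        rwa [← gal.injective h]
      · exact fun h => ⟨τ, h, rfl⟩
    have hcomm : ∀ x : CyclotomicField m ℚ, eL (τ x) = σ • eL x := fun x => by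
      rw [absoluteGaloisGroup.smul_def]
      exact AlgEquiv.restrictNormal_commutes (absoluteGaloisGroup.toAlgEquiv ℚ σ)
        (CyclotomicField m ℚ) x
    rw [hmemB, mem_range_absGaloisRestrict_iff_smul_absEmbedding,
      ← IntermediateField.fixingSubgroup_fixedField H, IntermediateField.mem_fixingSubgroup_iff]
    constructor
    · intro h x hx
      have key := h ⟨x, hx⟩
      rw [← heL ⟨x, hx⟩] at key
      apply eL.toRingHom.injective
      change eL (τ x) = eL x
      rw [hcomm]
      exact key
    · intro h x
      have hx := h (x : CyclotomicField m ℚ) x.2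
      rw [← heL x, ← hcomm]
      exact congrArg eL hx

open scoped Classical in
/-- **Orthogonality for the characters of `(ℤ/m)ˣ/B`.**  For a subgroup `B ≤ (ℤ/m)ˣ` and a unit
`u ∉ B`, `∑_{χ mod m, χ|_B = 1} χ(u) = 0`: there is a character `χ₀` trivial on `B` with
`χ₀(u) ≠ 1` (the characters trivial on `B ⊔ ⟨u⟩` are fewer, `card_filter_forall_apply_eq_one`),
and multiplication by `χ₀` permutes the characters trivial on `B`.
[cite: Washington1997, Ch. 3, Lemma 3.8 ff. (orthogonality relations)] -/
theorem sum_filter_forall_apply_eq_one_apply_eq_zero (B : Subgroup (ZMod m)ˣ) {u : (ZMod m)ˣ}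
    (hu : u ∉ B) :
    ∑ χ ∈ ({χ | ∀ b ∈ B, χ b = 1} : Finset (DirichletCharacter ℂ m)), χ u = 0 := by
  set Y : Finset (DirichletCharacter ℂ m) := {χ | ∀ b ∈ B, χ b = 1} with hY
  set Y' : Finset (DirichletCharacter ℂ m) := {χ | ∀ b ∈ B ⊔ Subgroup.zpowers u, χ b = 1} with hY'
  -- a character trivial on `B` but not at `u`
  have hlt : Y'.card < Y.card := by
    rw [hY, hY', Literature.NumberTheory.LFunctions.AbelianDedekindZeta.card_filter_forall_apply_eq_one,
      Literature.NumberTheory.LFunctions.AbelianDedekindZeta.card_filter_forall_apply_eq_one,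
      ← Literature.NumberTheory.LFunctions.AbelianDedekindZeta.orderOf_mk_mul_index_sup B u]
    have h1 : 1 < orderOf (QuotientGroup.mk u : (ZMod m)ˣ ⧸ B) := by
      rw [Nat.one_lt_iff_ne_zero_and_ne_one]
      refine ⟨(orderOf_pos (QuotientGroup.mk u : (ZMod m)ˣ ⧸ B)).ne', fun h => hu ?_⟩
      rw [orderOf_eq_one_iff, QuotientGroup.eq_one_iff] at h
      exact h
    have hpos : 0 < (B ⊔ Subgroup.zpowers u).index := Nat.pos_of_ne_zero Subgroup.index_ne_zero_of_finite
    exact lt_mul_left hpos h1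
  obtain ⟨χ₀, hχ₀Y, hχ₀Y'⟩ : ∃ χ₀ ∈ Y, χ₀ ∉ Y' := by
    by_contra h
    push Not at h
    exact absurd (Finset.card_le_card h) (not_le.mpr hlt)
  have hχ₀B : ∀ b ∈ B, χ₀ b = 1 := by simpa [hY] using hχ₀Y
  have hχ₀u : χ₀ u ≠ 1 := by
    intro h1
    apply hχ₀Y'
    simp only [hY', Finset.mem_filter, Finset.mem_univ, true_and]
    intro b hb
    have hle : B ⊔ Subgroup.zpowers u ≤ (MulChar.toUnitHom χ₀).ker := by
      rw [sup_le_iff, Subgroup.zpowers_le, MonoidHom.mem_ker, Units.ext_iff, MulChar.coe_toUnitHom]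
      refine ⟨fun x hx => ?_, h1⟩
      rw [MonoidHom.mem_ker, Units.ext_iff, MulChar.coe_toUnitHom]
      exact hχ₀B x hx
    have := hle hb
    rwa [MonoidHom.mem_ker, Units.ext_iff, MulChar.coe_toUnitHom] at this
  -- multiplication by `χ₀` permutes `Y`
  have hmemY : ∀ χ : DirichletCharacter ℂ m, χ ∈ Y ↔ ∀ b ∈ B, χ b = 1 := fun χ => by
    simp [hY]
  have hperm : ∑ χ ∈ Y, (χ₀ * χ) u = ∑ χ ∈ Y, χ u := by
    refine Finset.sum_nbij' (fun χ => χ₀ * χ) (fun χ => χ₀⁻¹ * χ) (fun χ hχ => ?_)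
      (fun χ hχ => ?_) (fun χ _ => inv_mul_cancel_left χ₀ χ) (fun χ _ => mul_inv_cancel_left χ₀ χ)
      (fun χ _ => rfl)
    · simp only [hmemY] at hχ ⊢
      intro b hb
      rw [MulChar.mul_apply, hχ₀B b hb, hχ b hb, one_mul]
    · simp only [hmemY] at hχ ⊢
      intro b hb
      rw [MulChar.mul_apply, MulChar.inv_apply_eq_inv', hχ₀B b hb, hχ b hb, inv_one, one_mul]
  have hsum : ∑ χ ∈ Y, (χ₀ * χ) u = χ₀ u * ∑ χ ∈ Y, χ u := by
    rw [Finset.mul_sum]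
    exact Finset.sum_congr rfl fun χ _ => by rw [MulChar.mul_apply]
  rw [hperm] at hsum
  have h : (1 - χ₀ u) * ∑ χ ∈ Y, χ u = 0 := by rw [sub_mul, one_mul, ← hsum, sub_self]
  rcases mul_eq_zero.mp h with h | h
  · exact absurd (sub_eq_zero.mp h).symm hχ₀u
  · exact h

/-- **A Dirichlet character as a continuous character of `Γ_ℚ` with values in any topological
ring `A` receiving `ℂ`** (`σ ↦ j(ε(χ_m(σ)))`, locally constant since `χ_m` is; the case
`A = ℂ`, `j = id` is the tree's `dirichletGaloisCharacter`). [cite: DeligneSerreASENS1974, §4.4] -/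
theorem exists_continuousMonoidHom_apply_eq_dirichlet {A : Type*} [CommRing A]
    [TopologicalSpace A] [IsTopologicalRing A] (j : ℂ →+* A) (ε : DirichletCharacter ℂ m) :
    ∃ ψ : absoluteGaloisGroup ℚ →ₜ* Aˣ, ∀ σ : absoluteGaloisGroup ℚ,
      (ψ σ : A) = j (ε (modNCyclotomicCharacter ℚ m σ : ZMod m)) := by
  haveI : NeZero ((m : ℕ) : ℚ) := NeZero.charZero
  set χ : absoluteGaloisGroup ℚ →* Aˣ :=
    (Units.map (j : ℂ →* A)).comp (ε.toUnitHom.comp (modNCyclotomicCharacter ℚ m)) with hχ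
  have hcont : Continuous χ := by
    refine continuous_of_continuousAt_one χ ?_
    rw [ContinuousAt, map_one]
    refine Filter.Tendsto.mono_right ?_ (pure_le_nhds 1)
    rw [Filter.tendsto_pure]
    filter_upwards [modNCyclotomicCharacter_eventually_eq_one ℚ m] with σ hσ
    simp only [hχ, MonoidHom.coe_comp, Function.comp_apply, hσ, map_one]
  refine ⟨⟨χ, hcont⟩, fun σ => ?_⟩
  change ((χ σ : Aˣ) : A) = _
  simp only [hχ, MonoidHom.coe_comp, Function.comp_apply, Units.coe_map, MonoidHom.coe_coe,
    MulChar.coe_toUnitHom]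

end Dictionary

/-! ### The twisted newforms `g_ε = (f_E ⊗ ε⋆)^{new}` -/

section TwistedNewform

open WeierstrassCurve

/-- **The newform attached to `E ⊗ ε`, modulo modularity.**  Assume the modularity theorem
(`exists_isNewformOf`).  For an elliptic curve `E/ℚ` and a Dirichlet character `ε` mod `m` there
is a newform `g ∈ S₂(Γ₁(N_g))` with `a_p(g) = ε(p) a_p(E)` and `ε_g(p) = ε(p)²` for every prime
`p ∤ N_E m`: the newform of `E` lifted to `Γ₁(N_E)` (`liftToGamma1`, trivial nebentypus) twisted
by the primitive character `ε⋆` inducing `ε` (`exists_isNewform1_twist`, Shimura Prop. 3.64 with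
Atkin–Li), and `ε⋆(p) = ε(p)` for `p ∤ m`.
[cite: Shimura1971, Prop. 3.64] [cite: DiamondShurman2005, Thm. 8.8.3] -/
theorem exists_isNewform1_cuspCoeff_eq_dirichlet_mul (hX : exists_isNewformOf)
    (W : WeierstrassCurve ℚ) [W.IsElliptic] {m : ℕ} [NeZero m] (ε : DirichletCharacter ℂ m) :
    ∃ (T₀ : ℕ) (_ : T₀ ≠ 0) (Ng : ℕ) (_ : NeZero Ng) (g : CuspForm (Gamma1 Ng) 2), IsNewform1 g ∧
      ∀ p : ℕ, p.Prime → ¬ p ∣ T₀ →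
        cuspCoeff g p = ε (p : ZMod m) * (W.LFunction p : ℂ) ∧
          (nebentypus g (p : ZMod Ng) : ℂ) = ε (p : ZMod m) ^ 2 := by
  set N := W.conductorNorm ℤ with hN
  haveI : NeZero N := ⟨(W.conductorNorm_pos_holds).ne'⟩
  haveI : NeZero ε.conductor := ⟨ε.conductor_ne_zero⟩
  obtain ⟨f, hf⟩ := hX W
  set f₁ := liftToGamma1 N 2 f with hf₁def
  have hf₁ : IsNewform1 f₁ := (isNewform1_liftToGamma1_iff_holds (N := N) (k := 2) f).mpr hf.1
  have hf0 : f ≠ 0 := by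
    intro h0
    have h1 : IsNormalized f := hf.1.2.2
    rw [IsNormalized, h0, CuspForm.coe_zero, UpperHalfPlane.qExpansion_zero, map_zero] at h1
    exact zero_ne_one h1
  have hneb : nebentypus f₁ = 1 := nebentypus_liftToGamma1_holds N 2 hf0
  obtain ⟨N₀, hN₀, -, g₀, hg₀, hcoef⟩ :=
    exists_isNewform1_twist hf₁ ε.primitiveCharacter_isPrimitive
  refine ⟨N * m, mul_ne_zero (NeZero.ne N) (NeZero.ne m), N₀, hN₀, g₀, hg₀, fun p hp hpT => ?_⟩
  have hpN : ¬ p ∣ N := fun h => hpT (h.mul_right m)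
  have hpm : ¬ p ∣ m := fun h => hpT (h.mul_left N)
  have hpc : ¬ p ∣ N * ε.conductor := by
    intro h
    rcases (Nat.Prime.dvd_mul hp).mp h with h | h
    · exact hpN h
    · exact hpm (h.trans ε.conductor_dvd_level)
  obtain ⟨h1, h2⟩ := hcoef p hp hpc
  have hcop : IsCoprime (p : ℤ) m :=
    Nat.isCoprime_iff_coprime.mpr (hp.coprime_iff_not_dvd.mpr hpm)
  have hε : ε.primitiveCharacter (p : ZMod ε.conductor) = ε (p : ZMod m) := by
    have := DirichletCharacter.primitiveCharacter_apply_of_isCoprime ε hcop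
    simpa using this
  have hf₁p : cuspCoeff f₁ p = (W.LFunction p : ℂ) := by
    rw [← hf.2 p, cuspCoeff, cuspCoeff, hf₁def, coe_liftToGamma1_holds N 2 f]
  have hunit : IsUnit (p : ZMod N) := (ZMod.isUnit_prime_iff_not_dvd hp).mpr hpN
  have hneb_p : (nebentypus f₁ (p : ZMod N) : ℂ) = 1 := by
    rw [hneb, MulChar.one_apply hunit]
  refine ⟨?_, ?_⟩
  · rw [h1, hε, hf₁p]
  · rw [h2, hε, hneb_p, one_mul]

end TwistedNewform

/-! ### The local identity at every prime: `∏_{w ∣ p} L_w(E_F, T^{f_w}) = ∏_ε E_p(g_ε, T)` -/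

section LocalIdentity

open WeierstrassCurve

variable (W : WeierstrassCurve ℚ) [W.IsElliptic] {m : ℕ} [NeZero m]
  (F : Type) [Field F] [NumberField F] [Algebra ℚ F] [FiniteDimensional ℚ F] [IsAbelianGalois ℚ F]

set_option maxHeartbeats 1600000 in
/-- **The local identity at every prime.**  Let `F/ℚ` be a finite abelian extension whose image
`res(Γ_F) ≤ Γ_ℚ` is cut out by a subgroup `B ≤ (ℤ/m)ˣ` through the mod-`m` cyclotomic character,
let `(ε_i)` be the Dirichlet characters mod `m` trivial on `B` (as many as `[F : ℚ]`, orthogonal off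
`B`), and let `g_i ∈ S₂(Γ₁(N_i))` be newforms with `a_p(g_i) = ε_i(p) a_p(E)`, `ε_{g_i}(p) = ε_i(p)²`
off finitely many `p` (the newforms of `E ⊗ ε_i`).  Assume Deligne's Galois representations for
`Γ₁`-newforms (`Hida2000_thm326_exists_galoisRep`) and Carayol's theorem in Euler-factor form
(hypothesis `hC`).  Then at **every** prime `p` — good, multiplicative or additive for `E`,
ramified or not in `F` —
`∏_{w ∣ p} L_w(E_F, T^{f(w|p)}) = ∏_i (1 - a_p(g_i) T + ε_{g_i}(p) p T²)` in `ℂ[T]`.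
Proof: choose a prime `ℓ ≠ p` and `ι : ℚ̄_ℓ ≅ ℂ`; by the abelian local Artin formalism for the
`ℓ`-adic Tate module (`map_prod_expand_localPolynomialAt_baseChange_eq_prod_twist`, Deligne 1973
Prop. 3.8 (ii) + Prop. 8.11) the left side is `∏_i det(1 - Frob T | (V_ℓ(E) ⊗ ψ_i)_{I_p})`,
`ψ_i` the Galois character of `ε_i`; each `V_ℓ(E) ⊗ ψ_i` is the `ℓ`-adic representation of `g_i`
(`nonempty_equiv_twist_of_isGaloisRepOfNewform1`), whose coinvariant Euler factor at `p ≠ ℓ` is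
`1 - a_p(g_i) T + ε_{g_i}(p) p T²` by Carayol (`map_reverse_charpoly_toInertiaCoinvariants_twist_eq`).
[cite: Rohrlich1997, §3.8 Thm. 5 and §3.9 (PDF pp. 152–156)]
[cite: CarayolASENS1986, Thm. (A) (0.7) with (0.5), (0.8), pp. 410–411]
[cite: DeligneAntwerpII1973, Prop. 3.8 (ii) (p. 530) and Prop. 8.11 (pp. 570–571)] -/
theorem map_prod_expand_localPolynomialAt_baseChange_eq_prod_heckeFactor
    (hD : Hida2000_thm326_exists_galoisRep)
    (hC : ∀ {N : ℕ} [NeZero N] {k : ℤ} (g : CuspForm (Gamma1 N) k), 2 ≤ k → IsNewform1 g →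
      ∀ (p : ℕ) [Fact p.Prime] (ι : PadicAlgCl p ≃+* ℂ) (ρ : FramedGaloisRep ℚ (PadicAlgCl p) 2),
        IsGaloisRepOfNewform1 g
          ((ι.symm : ℂ →+* PadicAlgCl p).comp (algebraMap (coeffCharField g) ℂ))
            {q | q ∣ N * p} ρ →
        ρ.toGaloisRep.IsIrreducible →
      ∀ ℓ : ℕ, ℓ.Prime → ℓ ≠ p →
      ∀ w : HeightOneSpectrum (𝓞 ℚ), (ℓ : 𝓞 ℚ) ∈ w.asIdeal → ∀ 𝔔 ∈ w.primesAbove,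
      ∀ σ : 𝔔.decompositionSubgroup (absoluteGaloisGroup ℚ),
        IsArithFrobAt (𝓞 ℚ) (σ : absoluteGaloisGroup ℚ) 𝔔 →
        (ρ.toGaloisRep.toInertiaCoinvariants 𝔔 σ).charpoly.reverse =
          1 - C (ι.symm (cuspCoeff g ℓ)) * X +
            C (ι.symm ((nebentypus g (ℓ : ZMod N) : ℂ) * (ℓ : ℂ) ^ (k - 1))) * X ^ 2)
    {ιX : Type} [Fintype ιX] (ε : ιX → DirichletCharacter ℂ m) (B : Subgroup (ZMod m)ˣ)
    (hB : ∀ σ : absoluteGaloisGroup ℚ,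
      σ ∈ (absGaloisRestrict ℚ F).range ↔ modNCyclotomicCharacter ℚ m σ ∈ B)
    (hεB : ∀ i, ∀ b ∈ B, ε i b = 1) (horth : ∀ u : (ZMod m)ˣ, u ∉ B → ∑ i, ε i u = 0)
    (hcard : Fintype.card ιX = Module.finrank ℚ F)
    {Ng : ιX → ℕ} [∀ i, NeZero (Ng i)] (g : ∀ i, CuspForm (Gamma1 (Ng i)) 2)
    (hgnew : ∀ i, IsNewform1 (g i)) {T₀ : ℕ} (hT₀ : T₀ ≠ 0)
    (hg : ∀ i (p : ℕ), p.Prime → ¬ p ∣ T₀ →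
      cuspCoeff (g i) p = ε i (p : ZMod m) * (W.LFunction p : ℂ) ∧
        (nebentypus (g i) (p : ZMod (Ng i)) : ℂ) = ε i (p : ZMod m) ^ 2)
    (v : HeightOneSpectrum (𝓞 ℚ)) [Fintype {w : HeightOneSpectrum (𝓞 F) // w.under (𝓞 ℚ) = v}] :
    (∏ w : {w : HeightOneSpectrum (𝓞 F) // w.under (𝓞 ℚ) = v},
        expand ℤ (w.1.asIdeal.inertiaDeg (𝓞 ℚ)) ((W.baseChange F).localPolynomialAt w.1)).map
        (Int.castRingHom ℂ) =
      ∏ i, (1 - C (cuspCoeff (g i) (primesEquiv v : ℕ)) * X +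
        C ((nebentypus (g i) ((primesEquiv v : ℕ) : ZMod (Ng i)) : ℂ) * ((primesEquiv v : ℕ) : ℂ)) *
          X ^ 2) := by
  classical
  haveI : NeZero ((m : ℕ) : ℚ) := NeZero.charZero
  set p : ℕ := ((primesEquiv v : Nat.Primes) : ℕ) with hpdef
  have hp : p.Prime := (primesEquiv v).2
  -- an auxiliary prime `ℓ ≠ p` and `ι : ℚ̄_ℓ ≅ ℂ`
  obtain ⟨ℓ, hℓge, hℓp⟩ := Nat.exists_infinite_primes (p + 1)
  haveI : Fact ℓ.Prime := ⟨hℓp⟩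
  have hℓne : ℓ ≠ p := by omega
  have hmemv : ∀ n : ℕ, (n : 𝓞 ℚ) ∈ v.asIdeal ↔ p ∣ n := fun n => by
    rw [hpdef, show ((primesEquiv v : Nat.Primes) : ℕ) = natGenerator v from rfl,
      natGenerator_dvd_iff, ← map_natCast (Rat.IsIntegralClosure.intEquiv (𝓞 ℚ)) n,
      Ideal.apply_mem_of_equiv_iff]
  have hℓv : (ℓ : 𝓞 ℚ) ∉ v.asIdeal := by
    rw [hmemv]
    intro h
    exact hℓne ((Nat.prime_dvd_prime_iff_eq hp hℓp).mp h).symm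
  obtain ⟨ι⟩ := PadicAlgCl.nonempty_ringEquiv_complex ℓ
  obtain ⟨VQ, eV, heV, hV⟩ := exists_framedGaloisRep_rationalTate W ℓ
  -- the Galois characters of the `ε i`
  choose ψ hψ using fun i =>
    exists_continuousMonoidHom_apply_eq_dirichlet m (ι.symm : ℂ →+* PadicAlgCl ℓ) (ε i)
  -- the `ℓ`-adic representations of the `g i`
  choose ρg hρg hirr using fun i => hD (g i) le_rfl (hgnew i) ℓ ι
  -- a prime `𝔓 ∣ p` of `ℤ̄` and an arithmetic Frobenius
  obtain ⟨𝔓, h𝔓⟩ := v.primesAbove_nonempty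
  obtain ⟨φ₀, hφ₀⟩ := HeightOneSpectrum.exists_isArithFrobAt_of_mem_primesAbove_holds h𝔓
  haveI := h𝔓.1
  have hφD : φ₀ ∈ 𝔓.decompositionSubgroup (absoluteGaloisGroup ℚ) := hφ₀.mem_stabilizer
  set φ : 𝔓.decompositionSubgroup (absoluteGaloisGroup ℚ) := ⟨φ₀, hφD⟩ with hφdef
  have hφ : IsArithFrobAt (𝓞 ℚ) (φ : absoluteGaloisGroup ℚ) 𝔓 := hφ₀
  -- hypotheses of the abelian local Artin formalism
  have hψ₁ : ∀ i (γ : absoluteGaloisGroup F), ψ i (absGaloisRestrict ℚ F γ) = 1 := by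
    intro i γ
    have hmem : absGaloisRestrict ℚ F γ ∈ (absGaloisRestrict ℚ F).range := ⟨γ, rfl⟩
    rw [hB] at hmem
    ext
    rw [hψ i, hεB i _ hmem, map_one, Units.val_one]
  have horth₁ : ∀ σ ∈ (absGaloisRestrict ℚ F).range,
      ∑ i, ((ψ i σ : (PadicAlgCl ℓ)ˣ) : PadicAlgCl ℓ) = Fintype.card ιX := by
    intro σ hσ
    rw [hB] at hσ
    simp_rw [hψ, hεB _ _ hσ, map_one]
    simp
  have horth₀ : ∀ σ ∉ (absGaloisRestrict ℚ F).range,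
      ∑ i, ((ψ i σ : (PadicAlgCl ℓ)ˣ) : PadicAlgCl ℓ) = 0 := by
    intro σ hσ
    rw [hB] at hσ
    simp_rw [hψ]
    rw [← map_sum, horth _ hσ, map_zero]
  have hCc := map_prod_expand_localPolynomialAt_baseChange_eq_prod_twist W F ℓ
    (algebraMap ℚ_[ℓ] (PadicAlgCl ℓ)) (continuous_algebraMap_padicAlgCl ℓ) VQ eV heV ψ hψ₁ horth₁
    horth₀ hcard hℓv h𝔓 φ hφ
  -- the characters `ψ i` at the primes `q ∤ m`
  have hψI : ∀ i (v' : HeightOneSpectrum (𝓞 ℚ)), ¬ ((primesEquiv v' : Nat.Primes) : ℕ) ∣ m →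
      ∀ 𝔓' ∈ v'.primesAbove, ∀ σ ∈ 𝔓'.inertia (absoluteGaloisGroup ℚ), ψ i σ = 1 := by
    intro i v' hv' 𝔓' h𝔓' σ hσ
    haveI := h𝔓'.1
    have hN := Rat.natCast_not_mem_of_mem_primesAbove_of_not_dvd h𝔓' hv'
    have h1 := modNCyclotomicCharacter_eq_one_of_mem_inertia (K := ℚ) (N := m) hN hσ
    ext
    rw [hψ i, h1, Units.val_one, map_one, map_one, Units.val_one]
  have hψF : ∀ i (v' : HeightOneSpectrum (𝓞 ℚ)), ¬ ((primesEquiv v' : Nat.Primes) : ℕ) ∣ m →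
      ∀ 𝔓' ∈ v'.primesAbove, ∀ σ : absoluteGaloisGroup ℚ, IsArithFrobAt (𝓞 ℚ) σ 𝔓' →
        (ψ i σ : PadicAlgCl ℓ) = ι.symm (ε i (((primesEquiv v' : Nat.Primes) : ℕ) : ZMod m)) := by
    intro i v' hv' 𝔓' h𝔓' σ hσ
    have hN := Rat.natCast_not_mem_of_mem_primesAbove_of_not_dvd h𝔓' hv'
    rw [hψ i, modNCyclotomicCharacter_eq_residueCard_of_isArithFrobAt h𝔓' hN hσ,
      FramedRep.residueCard_eq_coe_primesEquiv' v']
    rfl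
  -- Carayol, through the identification `V_ℓ(E) ⊗ ψ_i ≅ ρ_{g_i}`
  have hD4 : ∀ i, ((ContinuousRep.toInertiaCoinvariants (FramedGaloisRep.toGaloisRep
      ((VQ.baseChange (algebraMap ℚ_[ℓ] (PadicAlgCl ℓ)) (continuous_algebraMap_padicAlgCl ℓ)).twist
        (ψ i))) 𝔓 φ).charpoly.reverse).map (ι : PadicAlgCl ℓ →+* ℂ) =
      1 - C (cuspCoeff (g i) p) * X +
        C ((nebentypus (g i) (p : ZMod (Ng i)) : ℂ) * (p : ℂ)) * X ^ 2 := fun i =>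
    map_reverse_charpoly_toInertiaCoinvariants_twist_eq W ℓ ι VQ hV m
      (fun n => ε i (n : ZMod m)) (ψ i) (hψI i) (hψF i) (g i) (hgnew i) hT₀ (hg i) (ρg i)
      (hρg i) (hirr i) hC hℓv h𝔓 φ hφ
  apply_fun Polynomial.map (ι : PadicAlgCl ℓ →+* ℂ) at hCc
  rw [Polynomial.map_map, RingHom.ext_int ((ι : PadicAlgCl ℓ →+* ℂ).comp (Int.castRingHom _))
    (Int.castRingHom ℂ)] at hCc
  simp only [Polynomial.map_prod] at hCc
  rw [Polynomial.map_prod, hCc]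
  exact Finset.prod_congr rfl fun i _ => hD4 i

end LocalIdentity

/-! ### From the local identities to `L(E_F, s) = ∏_ε L(g_ε, s)` and the entire continuation -/

section Assembly

open WeierstrassCurve Complex

/-- **Euler products: the local identities give `L(E_F, s) = ∏_i L(g_i, s)` on `Re s > 2`.**
Let `X` be a Weierstrass curve over a number field `F`, `g_i ∈ S₂(Γ₁(N_i))` finitely many newforms,
and suppose that at every rational prime `p` the local polynomials of `X` at the places `w ∣ p`
and the Hecke polynomials of the `g_i` at `p` satisfy
`∏_{w ∣ p} L_w(X, T^{f(w|p)}) = ∏_i (1 - a_p(g_i) T + ε_{g_i}(p) p T²)`.  Then for `Re s > 2`,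
`L(X, s) = ∏_i L(g_i, s)`: both sides are absolutely convergent Euler products
(`hasProd_localPolynomialAt_inv_LSeries`, Silverman C.16; `IsNewform1.hasProd_cuspFormLSeries_holds`,
Deligne–Serre (1.7.2)), the one over the places of `F` regrouped over the rational primes
(`HasProd.sigma`), with the same factors at every `p` (evaluate the identity at `T = p^{-s}`,
`N w = p^{f(w|p)}`). [cite: Rohrlich1997, §3.9 (PDF pp. 154–156)] [cite: DeligneSerreASENS1974, (1.7.2)] -/
theorem LSeries_eq_prod_cuspFormLSeries_of_forall_map_prod_expand_eq
    {F : Type*} [Field F] [NumberField F] (XW : WeierstrassCurve F)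
    {ιX : Type*} [Fintype ιX] {Ng : ιX → ℕ} [∀ i, NeZero (Ng i)]
    (g : ∀ i, CuspForm (Gamma1 (Ng i)) 2) (hgnew : ∀ i, IsNewform1 (g i))
    [hfin : ∀ v : HeightOneSpectrum (𝓞 ℚ), Fintype {w : HeightOneSpectrum (𝓞 F) // w.under (𝓞 ℚ) = v}]
    (hloc : ∀ v : HeightOneSpectrum (𝓞 ℚ),
      (∏ w : {w : HeightOneSpectrum (𝓞 F) // w.under (𝓞 ℚ) = v},
          expand ℤ (w.1.asIdeal.inertiaDeg (𝓞 ℚ)) (XW.localPolynomialAt w.1)).map (Int.castRingHom ℂ) =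
        ∏ i, (1 - C (cuspCoeff (g i) (primesEquiv v : ℕ)) * X +
          C ((nebentypus (g i) ((primesEquiv v : ℕ) : ZMod (Ng i)) : ℂ) * ((primesEquiv v : ℕ) : ℂ)) *
            X ^ 2))
    {s : ℂ} (hs : 2 < s.re) :
    XW.LSeries s = ∏ i, cuspFormLSeries (g i) s := by
  classical
  have hs32 : (3 / 2 : ℝ) < s.re := by linarith
  -- the Euler product of `L(X, s)` over the places of `F`, regrouped over the places of `ℚ`
  set x : HeightOneSpectrum (𝓞 F) → ℂ := fun w ↦
    (Polynomial.aeval ((w.residueCard : ℂ) ^ (-s))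
      ((XW.localPolynomialAt w).map (Int.castRingHom ℚ)))⁻¹ with hx
  have hW : HasProd x (XW.LSeries s) := XW.hasProd_localPolynomialAt_inv_LSeries hs32
  set π : HeightOneSpectrum (𝓞 F) → HeightOneSpectrum (𝓞 ℚ) := fun w ↦ w.under (𝓞 ℚ) with hπ
  have hW' := (Equiv.hasProd_iff (Equiv.sigmaFiberEquiv π) (f := x) (a := XW.LSeries s)).mpr hW
  have hWv : HasProd (fun v : HeightOneSpectrum (𝓞 ℚ) ↦
      ∏ w : {w : HeightOneSpectrum (𝓞 F) // w.under (𝓞 ℚ) = v}, x w.1) (XW.LSeries s) :=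
    HasProd.sigma hW' fun v ↦ hasProd_fintype _
  -- the Euler products of the `L(g_i, s)` over the rational primes
  set y : ιX → Nat.Primes → ℂ := fun i q ↦
    (1 - cuspCoeff (g i) q * (q : ℂ) ^ (-s) +
      nebentypus (g i) (q : ZMod (Ng i)) * (q : ℂ) ^ (((2 : ℤ) : ℂ) - 1 - 2 * s))⁻¹ with hy
  have hG : ∀ i, HasProd (y i) (cuspFormLSeries (g i) s) := fun i ↦
    IsNewform1.hasProd_cuspFormLSeries_holds (hgnew i) (s := s) (by push_cast; linarith)
  have hGprod : HasProd (fun q : Nat.Primes ↦ ∏ i, y i q) (∏ i, cuspFormLSeries (g i) s) :=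
    hasProd_prod (s := Finset.univ) fun i _ ↦ hG i
  have hGv := (Equiv.hasProd_iff (primesEquiv (R := 𝓞 ℚ)) (f := fun q : Nat.Primes ↦ ∏ i, y i q)
    (a := ∏ i, cuspFormLSeries (g i) s)).mpr hGprod
  -- the factors agree at every rational prime
  have hfac : (fun v : HeightOneSpectrum (𝓞 ℚ) ↦
      ∏ w : {w : HeightOneSpectrum (𝓞 F) // w.under (𝓞 ℚ) = v}, x w.1) =
      (fun q : Nat.Primes ↦ ∏ i, y i q) ∘ primesEquiv := by
    funext v
    set p : ℕ := ((primesEquiv v : Nat.Primes) : ℕ) with hpdef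
    have hp : p.Prime := (primesEquiv v).2
    have hp0 : (p : ℂ) ≠ 0 := Nat.cast_ne_zero.mpr hp.ne_zero
    set Tz : ℂ := (p : ℂ) ^ (-s) with hTz
    -- left side: `∏_w L_w(X, (N w)^{-s}) = (∏_w expand L_w)(p^{-s})`
    have hleft : ∏ w : {w : HeightOneSpectrum (𝓞 F) // w.under (𝓞 ℚ) = v},
        Polynomial.aeval ((w.1.residueCard : ℂ) ^ (-s))
          ((XW.localPolynomialAt w.1).map (Int.castRingHom ℚ)) =
        (∏ i, (1 - C (cuspCoeff (g i) p) * X +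
          C ((nebentypus (g i) (p : ZMod (Ng i)) : ℂ) * (p : ℂ)) * X ^ 2)).eval Tz := by
      rw [← hloc v, Polynomial.eval_map, show Int.castRingHom ℂ = algebraMap ℤ ℂ from rfl,
        ← Polynomial.aeval_def, map_prod]
      refine Finset.prod_congr rfl fun w _ ↦ ?_
      have hq : (w.1.residueCard : ℂ) ^ (-s) = Tz ^ w.1.asIdeal.inertiaDeg (𝓞 ℚ) := by
        have hw : w.1.asIdeal.under (𝓞 ℚ) = v.asIdeal := by
          have h2 := congrArg HeightOneSpectrum.asIdeal w.2
          exact h2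
        rw [residueCard_eq_residueCard_pow_inertiaDeg (v := v) hw,
          FramedRep.residueCard_eq_coe_primesEquiv' v, ← hpdef, Nat.cast_pow,
          ← Complex.natCast_cpow_natCast_mul, Complex.cpow_nat_mul]
      rw [hq, show (Int.castRingHom ℚ) = algebraMap ℤ ℚ from rfl, Polynomial.aeval_map_algebraMap,
        Polynomial.expand_aeval]
    -- right side: `p^{2-1-2s} = p · (p^{-s})²`
    have hpow : (p : ℂ) ^ (((2 : ℤ) : ℂ) - 1 - 2 * s) = (p : ℂ) * Tz ^ 2 := by
      have h1 : (((2 : ℤ) : ℂ) - 1 - 2 * s) = 1 + ((2 : ℕ) : ℂ) * (-s) := by push_cast; ring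
      rw [h1, Complex.cpow_add _ _ hp0, Complex.cpow_one, Complex.cpow_nat_mul]
    have hright : ∏ i, (1 - cuspCoeff (g i) p * (p : ℂ) ^ (-s) +
        nebentypus (g i) (p : ZMod (Ng i)) * (p : ℂ) ^ (((2 : ℤ) : ℂ) - 1 - 2 * s)) =
        (∏ i, (1 - C (cuspCoeff (g i) p) * X +
          C ((nebentypus (g i) (p : ZMod (Ng i)) : ℂ) * (p : ℂ)) * X ^ 2)).eval Tz := by
      rw [Polynomial.eval_prod]
      refine Finset.prod_congr rfl fun i _ ↦ ?_
      rw [hpow]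
      simp only [Polynomial.eval_add, Polynomial.eval_sub, Polynomial.eval_one, Polynomial.eval_mul,
        Polynomial.eval_C, Polynomial.eval_X, Polynomial.eval_pow]
      ring
    simp only [Function.comp_apply, hx, hy]
    rw [Finset.prod_inv_distrib, Finset.prod_inv_distrib, hleft, ← hpdef, hright]
  rw [hfac] at hWv
  exact hWv.unique hGv

/-- **`L(E/F, s)` is entire for every abelian number field `F`, modulo modularity, Deligne's
representations and Carayol's theorem** — the named fact
`hasEntireLFunction_baseChange_fixedField` (`AnalyticRankOverNumberField`; BCDT 2001 Thm. A with
Artin formalism, Rohrlich 1997 §3.8–3.9) reduced, with all glue proved, to: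
`hX` the modularity theorem (`exists_isNewformOf`, BCDT Thm. A / Diamond–Shurman Thm. 8.8.3),
`hD` Deligne's `ℓ`-adic representations of `Γ₁`-newforms over `ℚ̄_ℓ` (`Hida2000_thm326_exists_galoisRep`,
itself reduced in the tree to Deligne–Serre Thm. 6.1), and `hC` Carayol's theorem (A) in
Euler-factor form (the coinvariant Euler factors of `ρ_{g,ℓ}` at every `p ≠ ℓ` are the Hecke
factors of `g`; Carayol 1986; stated inline, no named fact of the tree carries it yet).
Proof (Rohrlich §3.9): `F = ℚ(ζ_m)^H` is abelian with character group `X(F) = B^⊥`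
(`exists_subgroup_index_eq_and_mem_range_absGaloisRestrict_iff`); for `ε ∈ X(F)` let `g_ε` be the
newform of `E ⊗ ε` (`exists_isNewform1_cuspCoeff_eq_dirichlet_mul`); at every prime `p` the local
factors of `E_F` above `p` multiply to `∏_ε E_p(g_ε, T)`
(`map_prod_expand_localPolynomialAt_baseChange_eq_prod_heckeFactor` — the abelian local Artin
formalism for `V_ℓ(E)`, the identification `V_ℓ(E) ⊗ ψ_ε ≅ ρ_{g_ε,ℓ}`, and Carayol), so
`L(E_F, s) = ∏_ε L(g_ε, s)` on `Re s > 2`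
(`LSeries_eq_prod_cuspFormLSeries_of_forall_map_prod_expand_eq`); each `L(g_ε, s)` is entire
(Hecke, `exists_differentiable_eq_cuspFormLSeries_of_lt_re`), and the identity persists on
`Re s > 3/2` by analytic continuation (`LSeriesSummable_of_lt_re_holds`).
[cite: BCDTJAMS2001, Thm. A] [cite: Rohrlich1997, §3.8 Thm. 5, §3.9 (PDF pp. 152–156)]
[cite: CarayolASENS1986, Thm. (A) (0.7) with (0.5), (0.8), pp. 410–411] -/
theorem hasEntireLFunction_baseChange_fixedField_of_modularity_of_carayol
    (hX : exists_isNewformOf) (hD : Hida2000_thm326_exists_galoisRep)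
    (hC : ∀ {N : ℕ} [NeZero N] {k : ℤ} (g : CuspForm (Gamma1 N) k), 2 ≤ k → IsNewform1 g →
      ∀ (p : ℕ) [Fact p.Prime] (ι : PadicAlgCl p ≃+* ℂ) (ρ : FramedGaloisRep ℚ (PadicAlgCl p) 2),
        IsGaloisRepOfNewform1 g
          ((ι.symm : ℂ →+* PadicAlgCl p).comp (algebraMap (coeffCharField g) ℂ))
            {q | q ∣ N * p} ρ →
        ρ.toGaloisRep.IsIrreducible →
      ∀ ℓ : ℕ, ℓ.Prime → ℓ ≠ p →
      ∀ w : HeightOneSpectrum (𝓞 ℚ), (ℓ : 𝓞 ℚ) ∈ w.asIdeal → ∀ 𝔔 ∈ w.primesAbove,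
      ∀ σ : 𝔔.decompositionSubgroup (absoluteGaloisGroup ℚ),
        IsArithFrobAt (𝓞 ℚ) (σ : absoluteGaloisGroup ℚ) 𝔔 →
        (ρ.toGaloisRep.toInertiaCoinvariants 𝔔 σ).charpoly.reverse =
          1 - C (ι.symm (cuspCoeff g ℓ)) * X +
            C (ι.symm ((nebentypus g (ℓ : ZMod N) : ℂ) * (ℓ : ℂ) ^ (k - 1))) * X ^ 2) :
    hasEntireLFunction_baseChange_fixedField := by
  intro W _ m _ H
  classical
  haveI : NeZero ((m : ℕ) : ℚ) := NeZero.charZero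
  haveI hcyc : IsCyclotomicExtension {m} ℚ (CyclotomicField m ℚ) :=
    CyclotomicField.isCyclotomicExtension m ℚ
  haveI : IsAbelianGalois ℚ (CyclotomicField m ℚ) :=
    IsCyclotomicExtension.isAbelianGalois {m} ℚ (CyclotomicField m ℚ)
  haveI : IsAbelianGalois ℚ (IntermediateField.fixedField H) :=
    instIsAbelianGaloisSubtypeMemIntermediateField ℚ (CyclotomicField m ℚ)
      (IntermediateField.fixedField H)
  -- the character group `X(F) = B^⊥`
  obtain ⟨B, hBidx, hB⟩ := exists_subgroup_index_eq_and_mem_range_absGaloisRestrict_iff m H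
  set XF : Finset (DirichletCharacter ℂ m) := {χ | ∀ b ∈ B, χ b = 1} with hXF
  have hmemXF : ∀ χ : DirichletCharacter ℂ m, χ ∈ XF ↔ ∀ b ∈ B, χ b = 1 := fun χ ↦ by
    simp [hXF]
  have hcard : Fintype.card XF = Module.finrank ℚ (IntermediateField.fixedField H) := by
    rw [Fintype.card_coe, hXF,
      Literature.NumberTheory.LFunctions.AbelianDedekindZeta.card_filter_forall_apply_eq_one, hBidx]
  have hεB : ∀ i : XF, ∀ b ∈ B, (i : DirichletCharacter ℂ m) b = 1 := fun i ↦ (hmemXF i).mp i.2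
  have horth : ∀ u : (ZMod m)ˣ, u ∉ B → ∑ i : XF, (i : DirichletCharacter ℂ m) u = 0 := by
    intro u hu
    rw [Finset.sum_coe_sort XF (fun χ : DirichletCharacter ℂ m ↦ χ u)]
    exact sum_filter_forall_apply_eq_one_apply_eq_zero m B hu
  -- the twisted newforms `g_ε`
  choose T₀ hT₀ Ng hNg g hgnew hg using fun i : XF ↦
    exists_isNewform1_cuspCoeff_eq_dirichlet_mul hX W (i : DirichletCharacter ℂ m)
  haveI : ∀ i, NeZero (Ng i) := hNg
  set T : ℕ := ∏ i, T₀ i with hTdef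
  have hT : T ≠ 0 := Finset.prod_ne_zero_iff.mpr fun i _ ↦ hT₀ i
  have hg' : ∀ (i : XF) (p : ℕ), p.Prime → ¬ p ∣ T →
      cuspCoeff (g i) p = (i : DirichletCharacter ℂ m) (p : ZMod m) * (W.LFunction p : ℂ) ∧
        (nebentypus (g i) (p : ZMod (Ng i)) : ℂ) = (i : DirichletCharacter ℂ m) (p : ZMod m) ^ 2 :=
    fun i p hp hpT ↦ hg i p hp fun h ↦ hpT (h.trans (Finset.dvd_prod_of_mem _ (Finset.mem_univ i)))
  -- the local identity at every prime
  haveI hfin : ∀ v : HeightOneSpectrum (𝓞 ℚ),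
      Fintype {w : HeightOneSpectrum (𝓞 (IntermediateField.fixedField H)) // w.under (𝓞 ℚ) = v} :=
    fun v ↦ by
      haveI : Finite {w : HeightOneSpectrum (𝓞 (IntermediateField.fixedField H)) //
          w.under (𝓞 ℚ) = v} := by
        haveI := v.isMaximal
        have hfin := IsDedekindDomain.primesOver_finite v.asIdeal
          (𝓞 (IntermediateField.fixedField H))
        have hset : {w : HeightOneSpectrum (𝓞 (IntermediateField.fixedField H)) |
            w.under (𝓞 ℚ) = v}.Finite := by
          refine (hfin.preimage
            (f := fun w : HeightOneSpectrum (𝓞 (IntermediateField.fixedField H)) ↦ w.asIdeal)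
            fun _ _ _ _ h ↦ HeightOneSpectrum.ext h).subset fun w hw ↦ ?_
          exact ⟨w.isPrime, ⟨by rw [← hw]; rfl⟩⟩
        exact hset.to_subtype
      exact Fintype.ofFinite _
  have hloc := fun v : HeightOneSpectrum (𝓞 ℚ) ↦
    map_prod_expand_localPolynomialAt_baseChange_eq_prod_heckeFactor W
      (IntermediateField.fixedField H) hD hC (fun i : XF ↦ (i : DirichletCharacter ℂ m)) B hB hεB
      horth hcard g hgnew hT hg' v
  -- entire continuations of the `L(g_ε, s)`
  choose Lg hLgd hLgeq using fun i : XF ↦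
    exists_differentiable_eq_cuspFormLSeries_of_lt_re (strictWidthInfty_Gamma1 (Ng i)) (g i)
  refine ⟨fun s ↦ ∏ i, Lg i s, ?_, fun s hs ↦ ?_⟩
  · exact fun s ↦ DifferentiableAt.fun_finsetProd fun i _ ↦ hLgd i s
  · -- identity theorem on `Re s > 3/2`
    set WF := W.baseChange (IntermediateField.fixedField H) with hWF
    have hU : IsOpen {z : ℂ | (3 / 2 : ℝ) < z.re} := isOpen_lt continuous_const Complex.continuous_re
    have hconn : IsPreconnected {z : ℂ | (3 / 2 : ℝ) < z.re} :=
      (convex_halfSpace_re_gt (3 / 2 : ℝ)).isPreconnected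
    set a : ℕ → ℂ := (↑) ∘ WF.LFunction with ha
    have habs : LSeries.abscissaOfAbsConv a ≤ (3 / 2 : ℝ) :=
      LSeries.abscissaOfAbsConv_le_of_forall_lt_LSeriesSummable fun y hy ↦
        WF.LSeriesSummable_of_lt_re_holds (by simpa using hy)
    have hLan : AnalyticOnNhd ℂ (LSeries a) {z : ℂ | (3 / 2 : ℝ) < z.re} := by
      refine DifferentiableOn.analyticOnNhd (fun z hz ↦ ?_) hU
      have hz' : z ∈ {z : ℂ | LSeries.abscissaOfAbsConv a < z.re} :=
        lt_of_le_of_lt habs (by exact_mod_cast hz)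
      exact ((LSeries_differentiableOn a).differentiableAt
        ((Complex.isOpen_re_gt_EReal _).mem_nhds hz')).differentiableWithinAt
    have hRan : AnalyticOnNhd ℂ (fun s ↦ ∏ i, Lg i s) {z : ℂ | (3 / 2 : ℝ) < z.re} :=
      (show Differentiable ℂ (fun s ↦ ∏ i, Lg i s) from
        fun s ↦ DifferentiableAt.fun_finsetProd fun i _ ↦ hLgd i s).differentiableOn.analyticOnNhd hU
    have h3 : (3 : ℂ) ∈ {z : ℂ | (3 / 2 : ℝ) < z.re} := by
      simp only [Set.mem_setOf_eq]
      norm_num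
    have hev : (fun s ↦ ∏ i, Lg i s) =ᶠ[nhds (3 : ℂ)] LSeries a := by
      have hopen2 : IsOpen {z : ℂ | (2 : ℝ) < z.re} := isOpen_lt continuous_const Complex.continuous_re
      have hmem2 : (3 : ℂ) ∈ {z : ℂ | (2 : ℝ) < z.re} := by
        simp only [Set.mem_setOf_eq]
        norm_num
      filter_upwards [hopen2.mem_nhds hmem2] with z hz
      have hz2 : 2 < z.re := hz
      have hprod := LSeries_eq_prod_cuspFormLSeries_of_forall_map_prod_expand_eq WF g hgnew hloc hz2
      rw [Finset.prod_congr rfl fun i _ ↦ hLgeq i z (by push_cast; linarith), ← hprod]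
      rfl
    have key := hRan.eqOn_of_preconnected_of_eventuallyEq hLan hconn h3 hev hs
    simpa [ha, WeierstrassCurve.LSeries] using key

end Assembly

end Literature.NumberTheory.EllipticCurves

end
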